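import Literature.AlgebraicGeometry.Motives.GAGAKaehlerImmersionProofs
import Literature.AlgebraicGeometry.Motives.HodgeDecomposition
import Literature.Geometry.Kaehler.FubiniStudyConnectionForm
import Literature.Geometry.Kaehler.MatrixFormAlgebra
import Literature.Geometry.Kaehler.ComplexVectorBundle
import HarnessLib

/-!
# The tautological line bundle `𝒪(-1)|_{X^an}` of a projective variety and its Fubini–Study connection

Family `hodge`, layer `Literature/AlgebraicGeometry/Motives`. For a `k`-scheme `X` (`k ⊆ ℂ`) with a
closed immersion `ι : X ⟶ ℙᴺ_k` and an analytification `φ : M → X(ℂ)`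
(`IsAnalytification E X d φ`), the file `GAGAKaehlerImmersionProofs` constructs on the open cover
`Mⱼ = φ⁻¹(ι⁻¹D₊(xⱼ)(ℂ))` of `M` the holomorphic affine coordinates `Gⱼ = (ι^*(xᵢ/xⱼ) ∘ φ)ᵢ : M → ℂᴺ⁺¹`
(`AnalytificationKaehler.coordVec`, nowhere zero on `Mⱼ`), the cocycle rule `Gⱼ = (ι^*(xⱼ/xᵢ) ∘ φ)⁻¹ Gᵢ`
on `Mᵢ ∩ Mⱼ`, and the Kähler form `θ = Gⱼ^*β₀` (`fubiniStudyPullbackForm`, the restriction of the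
Fubini–Study form). This file packages the same data as a HOLOMORPHIC LINE BUNDLE WITH CONNECTION
in the cocycle format of `Literature/Geometry/Kaehler/ComplexVectorBundle` (Kobayashi (1987), Ch. I
§1) and computes its Chern character forms:

* `AnalytificationKaehler.tautologicalBundle ι hφ : SmoothComplexVectorBundle (Fin (N+1)) E M 1` —
  **the tautological line bundle `𝒪(-1)|_{X^an} = φ^*ι^*𝒪_{ℙᴺ}(-1)`**, the line sub-bundle of
  `M × ℂᴺ⁺¹` spanned by the lifts `Gⱼ` of `[G] : M → ℙᴺ(ℂ)`: cover `Mⱼ`, holomorphic frames `sⱼ = Gⱼ`,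
  transition functions `g_ij = ι^*(xᵢ/xⱼ) ∘ φ` (`sⱼ = sᵢ g_ij`, Kobayashi's convention (1.15), i.e.
  `Gⱼ = (xᵢ/xⱼ) Gᵢ`); a holomorphic cocycle (`tautologicalBundle_isHolomorphic`). Griffiths–Harris
  (1978), p. 145 (the universal bundle `J` on `ℙⁿ`, `J = [-H]`, transition functions `zᵢ/zⱼ`);
  Voisin (2002), §3.3.2 (`S ⊂ ℙⁿ × ℂⁿ⁺¹`, `σⱼ = (Zᵢ/Zⱼ)σᵢ`); Hartshorne II Thm. 7.1 (the `xᵢ` generate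
  `ι^*𝒪(1)`).
* `AnalytificationKaehler.tautologicalConnection ι hφ` — **the Chern connection of the metric
  `h(sⱼ, sⱼ) = ‖Gⱼ‖²` induced by `ℂᴺ⁺¹` on `𝒪(-1)`**: connection forms `ωⱼ = ∂ log hⱼ = Gⱼ^*γ₀`,
  `γ₀ = ∂ log ‖Z‖²` (`FubiniStudyConnectionForm.fsConnectionPullback`); the gauge law (1.16)
  `ωⱼ = ωᵢ + g_ij⁻¹ dg_ij` is `fsConnectionPullback_smul_apply`. Griffiths–Harris, p. 73
  (`θ = ∂ log h`) and pp. 30–31; Voisin (2002), §3.3.2 proof of Lemma 3.16 (the metric `h` on `S`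
  induced by `ℂⁿ⁺¹`, `h(σᵢ) = 1 + Σ|z_k|²`); Kobayashi, Ch. I (4.9)–(4.12).
* `curvature_tautologicalConnection_apply` — **its curvature is `Ωⱼ = dωⱼ = i θ`** on `Mⱼ`
  (`d(G^*γ₀) = i G^*β₀`, `ω ∧ ω = 0` in rank one): the Chern form `(i/2π) Ω = -Ω/2πi` of
  `(𝒪(-1), h)` is `-θ/2π` — "`ω_{𝒪(-1)} = -ω_FS`", Voisin (2002), Lemma 3.16 proof
  ("`(1/2iπ) ∂∂̄ log h(σᵢ)` … `ω` is positive" for the DUAL `𝒪(1)`, Thm. 3.13); Griffiths–Harris,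
  p. 141 with p. 30.
* `npow_curvature_tautologicalConnection_apply`, `chernCharacterForm_tautologicalConnection_apply` —
  hence `Ωⱼᵖ = iᵖ θᵖ` and **`ch_p(𝒪(-1), D)|_{Mⱼ} = (1/p!) (-θ/2π)ᵖ`** (Kobayashi, Ch. II (2.21):
  `ch_p = (1/p!) tr((-Ω/2πi)ᵖ)`), the powers `θᵖ` being written `kaehlerFormPow g p` for any metric
  `g` whose Kähler form is `θ` at the point (the Kähler metric of `GAGAKaehlerImmersionProofs`).

Everything is PROVED; no named facts. Consumer:
`Literature/AlgebraicGeometry/HodgeTheory/HolomorphicBundleChernCharacterTopDegree` (the top-degree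
case `p = dim X` of Voisin I, Thm. 11.32 ⊗ ℂ, `span_holomorphicBundleChernCharacter_eq_algebraicClasses`:
`ch_n(𝒪(-1)) = (-1)ⁿ[θ]ⁿ/(2π)ⁿ n! ≠ 0` spans `H²ⁿ`).

## References

* P. Griffiths, J. Harris, *Principles of Algebraic Geometry* (Wiley 1978), Ch. 0 §2 pp. 30–31,
  Ch. 0 §5 pp. 71–73, Ch. 1 §1 pp. 141, 144–145. [GriffithsHarris1978]
* S. Kobayashi, *Differential Geometry of Complex Vector Bundles* (1987), Ch. I §1 (1.12),
  (1.15)–(1.16), §4 (4.9)–(4.12); Ch. II §2 (2.21). [Kobayashi1987]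
* C. Voisin, *Hodge Theory and Complex Algebraic Geometry I* (CUP 2002), §3.3.1 Def. 3.5, Thm. 3.13,
  §3.3.2 Lemma 3.16, §11.2. [VoisinHodgeI2002]
* R. Hartshorne, *Algebraic Geometry* (1977), II Thm. 7.1. [Hartshorne1977]
-/

noncomputable section

open scoped Manifold ContDiff Topology InnerProductSpace
open CategoryTheory AlgebraicGeometry Complex Set Filter

namespace Literature.AlgebraicGeometry.Motives

namespace AnalytificationKaehler

open Literature.NumberTheory.Transcendental Literature.Geometry.Kaehler Bundle

/-! ### Two pieces of linear algebra -/

/-- A complex `1`-form has vanishing wedge square, pointwise: `α ∧ α = 0`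
(`(α ∧ α)(v₀, v₁) = α(v₀)α(v₁) - α(v₁)α(v₀)`). [folklore] -/
theorem wedge_self_apply_eq_zero {E : Type*} [NormedAddCommGroup E] [NormedSpace ℂ E]
    {M : Type*} [TopologicalSpace M] [ChartedSpace E M] (α : MForm 𝓘(ℝ, E) M ℂ 1) (m : M) :
    (α.wedge α) m = 0 := by
  have key : ∀ a : E [⋀^Fin 1]→L[ℝ] ℂ, a.wedge a = 0 := fun a ↦ by
    ext v
    simp only [ContinuousAlternatingMap.wedge_apply_one_one, ContinuousAlternatingMap.coe_zero,
      Pi.zero_apply]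
    ring
  exact key (α m)

/-- Complexification commutes with the wedge product, pointwise: `(a ∧ b) ⊗ 1 = (a ⊗ 1) ∧ (b ⊗ 1)`
for real alternating forms `a`, `b` (the shuffle formula has rational coefficients). [folklore] -/
theorem ofRealCLM_compContinuousAlternatingMap_wedge {V : Type*} [NormedAddCommGroup V]
    [NormedSpace ℝ V] {p q : ℕ} (a : V [⋀^Fin p]→L[ℝ] ℝ) (b : V [⋀^Fin q]→L[ℝ] ℝ) :
    (Complex.ofRealCLM.compContinuousAlternatingMap a).wedge (Complex.ofRealCLM.compContinuousAlternatingMap b) =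
      Complex.ofRealCLM.compContinuousAlternatingMap (a.wedge b) := by
  ext v
  simp only [ContinuousAlternatingMap.wedge_apply, ContinuousLinearMap.compContinuousAlternatingMap_coe,
    Function.comp_apply, Complex.ofRealCLM_apply, Units.smul_def, zsmul_eq_mul, Complex.real_smul,
    smul_eq_mul]
  push_cast
  rfl

variable {k : Type} [Field k] [Algebra k ℂ] {X : SchemeOver k}
  {M : Type*} {E : Type*} [NormedAddCommGroup E] [NormedSpace ℂ E] [FiniteDimensional ℂ E]
  [TopologicalSpace M] [ChartedSpace E M]
  {N : ℕ} {ι : X ⟶ projectiveSpace N k} {φ : M → ComplexPoints X} {d : ℕ}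

/-! ### The cocycle of affine coordinates -/

omit [TopologicalSpace M] in
/-- **The cocycle rule on values**: on `Mᵢ ∩ Mⱼ`, `ι^*(xⱼ/xᵢ) · ι^*(x_l/xⱼ) = ι^*(x_l/xᵢ)` (read on
`M` through `φ`). [cite: Hartshorne1977, II Thm. 7.1] -/
theorem coordFun_mul_coordFun {i j : Fin (N + 1)} {m : M} (hi : m ∈ chartDom ι φ i)
    (hj : m ∈ chartDom ι φ j) (l : Fin (N + 1)) :
    coordFun ι φ i m j * coordFun ι φ j m l = coordFun ι φ i m l := by
  simp only [coordFun, AlgPoints.evalOrZero_of_mem _ (pt_mem_of_mem_chartDom hi),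
    AlgPoints.evalOrZero_of_mem _ (pt_mem_of_mem_chartDom hj)]
  exact GeneratingSections.eval_ratio_mul_eval_ratio ι i j l (φ m) hi hj

omit [TopologicalSpace M] in
/-- On `Mᵢ ∩ Mⱼ` the transition values are mutually inverse: `ι^*(xⱼ/xᵢ) · ι^*(xᵢ/xⱼ) = 1`.
[cite: Hartshorne1977, II Thm. 7.1] -/
theorem coordFun_mul_coordFun_symm {i j : Fin (N + 1)} {m : M} (hi : m ∈ chartDom ι φ i)
    (hj : m ∈ chartDom ι φ j) : coordFun ι φ i m j * coordFun ι φ j m i = 1 := by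
  rw [coordFun_mul_coordFun hi hj, coordFun_self hi]

omit [TopologicalSpace M] in
/-- On `Mᵢ ∩ Mⱼ`, `ι^*(xᵢ/xⱼ) = (ι^*(xⱼ/xᵢ))⁻¹`. [cite: Hartshorne1977, II Thm. 7.1] -/
theorem coordFun_symm_eq_inv {i j : Fin (N + 1)} {m : M} (hi : m ∈ chartDom ι φ i)
    (hj : m ∈ chartDom ι φ j) : coordFun ι φ j m i = (coordFun ι φ i m j)⁻¹ :=
  eq_inv_of_mul_eq_one_right (coordFun_mul_coordFun_symm hi hj)

section Holomorphic

variable (hφ : IsAnalytification E X d φ)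
include hφ

/-- **The frames of two charts differ by the transition function, as germs**: near a point of
`Mᵢ ∩ Mⱼ`, `Gⱼ = (ι^*(xᵢ/xⱼ) ∘ φ) · Gᵢ` (Voisin (2002), §3.3.2: `σⱼ = (Zᵢ/Zⱼ) σᵢ`).
[cite: VoisinHodgeI2002, §3.3.2] -/
theorem coordVec_eventuallyEq_smul {i j : Fin (N + 1)} {m : M} (hi : m ∈ chartDom ι φ i)
    (hj : m ∈ chartDom ι φ j) :
    coordVec ι φ j =ᶠ[𝓝 m] fun y ↦ coordFun ι φ j y i • coordVec ι φ i y := by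
  filter_upwards [((isOpen_chartDom hφ i).inter (isOpen_chartDom hφ j)).mem_nhds ⟨hi, hj⟩]
    with y hy
  rw [coordVec_eq_smul hy.1 hy.2, coordFun_symm_eq_inv hy.1 hy.2]

variable [IsClosedImmersion ι.left] [IsManifold 𝓘(ℂ, E) ω M] [IsManifold 𝓘(ℝ, E) ∞ M]

/-- The affine coordinates are real `C^∞` at the points of their chart (holomorphic on an open
set). [cite: SerreGAGA1956, §2 n°5 Lemme 1] -/
theorem contMDiffAt_coordFun {j : Fin (N + 1)} {m : M} (hm : m ∈ chartDom ι φ j) (i : Fin (N + 1)) :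
    ContMDiffAt 𝓘(ℝ, E) 𝓘(ℝ, ℂ) ∞ (fun x ↦ coordFun ι φ j x i) m :=
  contMDiffAt_real_of_mdifferentiableOn_complex (mdifferentiableOn_coordFun hφ j i)
    (isOpen_chartDom hφ j) hm

end Holomorphic

/-! ### The tautological line bundle `𝒪(-1)|_{X^an}` -/

section Bundle

variable (ι) (hφ : IsAnalytification E X d φ) [IsClosedImmersion ι.left]
  [IsManifold 𝓘(ℂ, E) ω M] [IsManifold 𝓘(ℝ, E) ∞ M]

/-- **The tautological line bundle `𝒪(-1)|_{X^an} = φ^*ι^*𝒪_{ℙᴺ}(-1)` as a holomorphic line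
cocycle**: on the cover `Mⱼ = φ⁻¹(ι⁻¹D₊(xⱼ)(ℂ))` the frames are the lifts `sⱼ = Gⱼ = (xᵢ/xⱼ)ᵢ` of
`[G] : M → ℙᴺ(ℂ)` to `ℂᴺ⁺¹ ∖ {0}`, and since `Gⱼ = (xᵢ/xⱼ) Gᵢ` the transition functions (Kobayashi's
convention `sⱼ = sᵢ g_ij`) are `g_ij = ι^*(xᵢ/xⱼ) ∘ φ`, holomorphic and non-vanishing on `Mᵢ ∩ Mⱼ`,
with `g_ii = 1` and the cocycle rule `g_ij g_jl = g_il` (Griffiths–Harris (1978), pp. 144–145, the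
universal bundle `J = [-H]`; Voisin (2002), §3.3.2; Hartshorne II Thm. 7.1).
[cite: GriffithsHarris1978, Ch. 1 §1 pp. 144–145] -/
def tautologicalBundle : SmoothComplexVectorBundle (Fin (N + 1)) E M 1 where
  baseSet j := chartDom ι φ j
  isOpen_baseSet j := isOpen_chartDom hφ j
  exists_mem_baseSet := exists_mem_chartDom
  coordChange i j m := Matrix.of fun _ _ ↦ coordFun ι φ j m i
  contMDiffOn_coordChange i j _ _ m hm := (contMDiffAt_coordFun hφ hm.2 i).contMDiffWithinAt
  coordChange_self i m hm := by
    ext a b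
    rw [Subsingleton.elim a b, Matrix.of_apply, Matrix.one_apply_eq, coordFun_self hm]
  coordChange_comp i j l m hm := by
    ext a b
    rw [Matrix.mul_apply, Fin.sum_univ_one, Matrix.of_apply, Matrix.of_apply, Matrix.of_apply, mul_comm,
      coordFun_mul_coordFun hm.2 hm.1.2]

/-- The trivialising sets of the tautological bundle are the chart domains `Mⱼ` (definitional).
[folklore] -/
@[simp]
theorem tautologicalBundle_baseSet (j : Fin (N + 1)) : (tautologicalBundle ι hφ).baseSet j = chartDom ι φ j :=
  rfl

/-- The transition functions of the tautological bundle are `g_ij = ι^*(xᵢ/xⱼ) ∘ φ` (definitional).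
[cite: GriffithsHarris1978, Ch. 1 §1 pp. 144–145] -/
@[simp]
theorem tautologicalBundle_coordChange_apply (i j : Fin (N + 1)) (m : M) (a b : Fin 1) :
    (tautologicalBundle ι hφ).coordChange i j m a b = coordFun ι φ j m i :=
  rfl

/-- **The tautological bundle is a holomorphic cocycle** (its transition functions are regular,
hence holomorphic, on `Mᵢ ∩ Mⱼ`). [cite: SerreGAGA1956, §2 n°5 Lemme 1] -/
theorem tautologicalBundle_isHolomorphic : (tautologicalBundle ι hφ).IsHolomorphic := fun i j _ _ ↦
  (mdifferentiableOn_coordFun hφ j i).mono inter_subset_right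

/-! ### The Fubini–Study (Chern) connection on `𝒪(-1)` -/

/-- **The Chern connection of the metric induced by `ℂᴺ⁺¹` on `𝒪(-1)|_{X^an}`**: in the
holomorphic frame `sⱼ = Gⱼ` the metric is `hⱼ = h(sⱼ, sⱼ) = ‖Gⱼ‖²` and the connection form is
`ωⱼ = ∂ log hⱼ = Gⱼ^*γ₀` (`fsConnectionPullback`; Griffiths–Harris (1978), p. 73: `θ = ∂ log h`;
Voisin (2002), §3.3.2; Kobayashi (1987), Ch. I (4.12)). The gauge law (1.16)
`ωⱼ = ωᵢ + g_ij⁻¹ dg_ij` holds because `Gⱼ = g_ij Gᵢ` (`fsConnectionPullback_smul_apply`).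
[cite: GriffithsHarris1978, Ch. 0 §5 p. 73] -/
def tautologicalConnection : (tautologicalBundle ι hφ).Connection where
  form j := Matrix.of fun _ _ ↦ fsConnectionPullback E (coordVec ι φ j)
  isSmoothFormOn_form j _ _ m hm :=
    smoothAt_fsConnectionPullback (mdifferentiableOn_coordVec hφ j) (isOpen_chartDom hφ j) hm
      (coordVec_ne_zero hm)
  form_eq i j m hm a b := by
    obtain ⟨hi, hj⟩ := hm
    have htne : coordFun ι φ j m i ≠ 0 := (coordFun_ne_zero_iff hj).2 hi
    have hf : MDifferentiableAt 𝓘(ℂ, E) 𝓘(ℂ, ℂ) (fun y ↦ coordFun ι φ j y i) m :=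
      mdifferentiableAt_coordFun hφ hj i
    have hfR : MDifferentiableAt 𝓘(ℝ, E) 𝓘(ℝ, ℂ) (fun y ↦ coordFun ι φ j y i) m :=
      (contMDiffAt_coordFun hφ hj i).mdifferentiableAt (by simp)
    have hG : MDifferentiableAt 𝓘(ℂ, E) 𝓘(ℂ, EuclideanSpace ℂ (Fin (N + 1))) (coordVec ι φ i) m :=
      mdifferentiableAt_coordVec hφ hi
    ext v
    simp only [Matrix.of_apply, MatrixForm.mulRight_apply, MatrixForm.mulLeft_apply, Fin.sum_univ_one,
      MatrixForm.d_apply, MatrixForm.ofFun_apply, tautologicalBundle_coordChange_apply,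
      ContinuousAlternatingMap.add_apply, ContinuousAlternatingMap.smul_apply, smul_eq_mul]
    rw [eq_vecCons_one v, fsConnectionPullback_congr_of_eventuallyEq (coordVec_eventuallyEq_smul hφ hi hj),
      fsConnectionPullback_smul_apply hf hG htne (coordVec_ne_zero hi),
      mextDeriv_ofFun_apply_eq_mvfderiv hfR, coordFun_symm_eq_inv hj hi]
    simp only [Matrix.cons_val_zero]
    field_simp

/-- The connection forms of the Fubini–Study connection on `𝒪(-1)` are `ωⱼ = Gⱼ^*γ₀`
(definitional). [cite: GriffithsHarris1978, Ch. 0 §5 p. 73] -/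
@[simp]
theorem tautologicalConnection_form_apply (j : Fin (N + 1)) (a b : Fin 1) :
    (tautologicalConnection ι hφ).form j a b = fsConnectionPullback E (coordVec ι φ j) :=
  rfl

/-! ### Curvature and Chern character forms -/

/-- **The curvature of the Fubini–Study connection on `𝒪(-1)` is `i θ`**, `θ` the Kähler form of
`GAGAKaehlerImmersionProofs` (the restricted Fubini–Study form): on `Mⱼ`,
`Ωⱼ = dωⱼ + ωⱼ ∧ ωⱼ = d(Gⱼ^*γ₀) = i Gⱼ^*β₀ = i θ`; equivalently the Chern form `(i/2π) Ω = -Ω/2πi`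
of `(𝒪(-1), h)` is `-θ/2π` (Voisin (2002), proof of Lemma 3.16 and Thm. 3.13: the dual `𝒪(1)` is
positive with Chern form the Fubini–Study form; Griffiths–Harris (1978), p. 141 with pp. 30–31;
Kobayashi (1987), Ch. I (1.12)). [cite: VoisinHodgeI2002, §3.3.2 Lemma 3.16] -/
theorem curvature_tautologicalConnection_apply {j : Fin (N + 1)} {m : M} (hm : m ∈ chartDom ι φ j)
    (a b : Fin 1) :
    (tautologicalConnection ι hφ).curvature j a b m = I • (fubiniStudyPullbackForm E ι φ).ofReal m := by
  have hθ : fubiniStudyPullbackForm E ι φ m = fsPullback E (coordVec ι φ j) m :=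
    fsPullback_coordVec_eq hφ hm (mem_chartDom_chartIndex m)
  change mextDeriv ((tautologicalConnection ι hφ).form j a b) m +
      (∑ c, ((tautologicalConnection ι hφ).form j a c).wedge ((tautologicalConnection ι hφ).form j c b)) m = _
  simp only [tautologicalConnection_form_apply, Fin.sum_univ_one]
  rw [wedge_self_apply_eq_zero, add_zero,
    mextDeriv_fsConnectionPullback (mdifferentiableOn_coordVec hφ j) (isOpen_chartDom hφ j) hm
      (coordVec_ne_zero hm)]
  exact congrArg (fun a : E [⋀^Fin 2]→L[ℝ] ℝ ↦
    I • (Complex.ofRealCLM.compContinuousAlternatingMap a : E [⋀^Fin 2]→L[ℝ] ℂ)) hθ.symm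

/-- **The powers of the curvature: `Ωⱼᵖ = iᵖ θᵖ` on `Mⱼ`** (rank one: the `1 × 1` matrix wedge
powers are the wedge powers of the entry). The powers `θᵖ` are written `kaehlerFormPow g p` for any
Riemannian metric `g` whose Kähler form agrees with `θ` at the point (the Kähler metric of the smooth
projective variety, `isKaehlerManifold_of_isAnalytification_of_isClosedImmersion_holds`).
[cite: Kobayashi1987, Ch. II §2 (2.21)] -/
theorem npow_curvature_tautologicalConnection_apply
    (g : RiemannianMetric (fun x : M ↦ TangentSpace 𝓘(ℝ, E) x)) {j : Fin (N + 1)} {m : M}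
    (hm : m ∈ chartDom ι φ j) (hg : g.kaehlerForm m = fubiniStudyPullbackForm E ι φ m) (p : ℕ)
    (a b : Fin 1) :
    MatrixForm.npow ((tautologicalConnection ι hφ).curvature j) p a b m = (I ^ p) • (kaehlerFormPow g p).ofReal m := by
  induction p generalizing a b with
  | zero =>
    rw [Subsingleton.elim a b, pow_zero, one_smul, MatrixForm.npow_zero, MatrixForm.one,
      Matrix.diagonal_apply_eq]
    ext v
    rw [MForm.ofReal_apply, kaehlerFormPow_zero, MForm.castDeg_apply, MForm.const_apply, Complex.ofReal_one]
    rfl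
  | succ p ih =>
    have h1 := ih a 0
    have h2 : (tautologicalConnection ι hφ).curvature j 0 b m =
        I • (Complex.ofRealCLM.compContinuousAlternatingMap (g.kaehlerForm m : E [⋀^Fin 2]→L[ℝ] ℝ) :
          E [⋀^Fin 2]→L[ℝ] ℂ) :=
      (curvature_tautologicalConnection_apply ι hφ hm 0 b).trans
        (congrArg (fun a : E [⋀^Fin 2]→L[ℝ] ℝ ↦
          I • (Complex.ofRealCLM.compContinuousAlternatingMap a : E [⋀^Fin 2]→L[ℝ] ℂ)) hg.symm)
    have key : ∀ (A : E [⋀^Fin (2 * p)]→L[ℝ] ℝ) (B : E [⋀^Fin 2]→L[ℝ] ℝ) (w : Fin (2 * p + 2) → E),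
        ((I ^ p • Complex.ofRealCLM.compContinuousAlternatingMap A).wedge
            (I • Complex.ofRealCLM.compContinuousAlternatingMap B)) w = I ^ (p + 1) * ((A.wedge B) w : ℂ) := by
      intro A B w
      rw [ContinuousAlternatingMap.algebra_smul_wedge, ContinuousAlternatingMap.wedge_algebra_smul,
        smul_smul, ← pow_succ, ofRealCLM_compContinuousAlternatingMap_wedge]
      rfl
    ext v
    rw [MatrixForm.npow_succ, MatrixForm.castDeg_apply, MForm.castDeg_apply]
    change (∑ c, (MatrixForm.npow ((tautologicalConnection ι hφ).curvature j) p a c).wedge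
      ((tautologicalConnection ι hφ).curvature j c b)) m _ = _
    rw [Fin.sum_univ_one, MForm.wedge_apply, h1, h2]
    refine (key (kaehlerFormPow g p m) (g.kaehlerForm m) _).trans ?_
    rfl

/-- The normalising constant: `(-1/2πi) · i = -1/2π`. [folklore] -/
theorem neg_one_div_two_pi_I_mul_I : (-1 / (2 * Real.pi * I)) * I = -(2 * (Real.pi : ℂ))⁻¹ := by
  have hπ : (Real.pi : ℂ) ≠ 0 := Complex.ofReal_ne_zero.2 Real.pi_ne_zero
  rw [div_mul_eq_mul_div, div_eq_iff (mul_ne_zero (mul_ne_zero two_ne_zero hπ) I_ne_zero)]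
  field_simp

/-- **The Chern character forms of `(𝒪(-1)|_{X^an}, D_FS)`: `ch_p|_{Mⱼ} = (1/p!) (-θ/2π)ᵖ`**, i.e.
`(1/p!) tr((-Ωⱼ/2πi)ᵖ) = (1/p!) (-1/2π)ᵖ θᵖ` at every point of `Mⱼ` (Kobayashi (1987), Ch. II (2.21),
with `Ωⱼ = iθ`; Voisin (2002), Lemma 3.16: `c₁(𝒪(-1)) = -[ω_FS]`). [cite: Kobayashi1987, Ch. II §2 (2.21)] -/
theorem chernCharacterForm_tautologicalConnection_apply
    (g : RiemannianMetric (fun x : M ↦ TangentSpace 𝓘(ℝ, E) x)) {j : Fin (N + 1)} {m : M}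
    (hm : m ∈ chartDom ι φ j) (hg : g.kaehlerForm m = fubiniStudyPullbackForm E ι φ m) (p : ℕ) :
    (tautologicalConnection ι hφ).chernCharacterForm p j m =
      ((p.factorial : ℂ)⁻¹ * (-(2 * (Real.pi : ℂ))⁻¹) ^ p) • (kaehlerFormPow g p).ofReal m := by
  rw [SmoothComplexVectorBundle.Connection.chernCharacterForm, Pi.smul_apply, Matrix.trace_fin_one,
    npow_curvature_tautologicalConnection_apply ι hφ g hm hg p 0 0, smul_smul, mul_assoc, ← mul_pow,
    neg_one_div_two_pi_I_mul_I]

end Bundle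

end AnalytificationKaehler

end Literature.AlgebraicGeometry.Motives

end
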